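import Literature.NumberTheory.EllipticCurves.BSDRankZeroDensity
import Literature.NumberTheory.EllipticCurves.LeadingTermBSZAssemblyProofs
import Literature.NumberTheory.EllipticCurves.LeadingTermBSZNonsplitDensityProofs
import Mathlib.Topology.Order.OrderClosed
import Mathlib.Topology.Algebra.Order.Field
import Mathlib.Tactic.FunProp
import HarnessLib

/-!
# Bhargava–Skinner–Zhang 2014, §3 bookkeeping (i): densities ↔ counts, the `E_{A,B} ↦ E_{A,−B}` halving, and lower densities over disjoint cells

Source: M. Bhargava, C. Skinner, W. Zhang, *A majority of elliptic curves over `ℚ` satisfy the Birch and Swinnerton-Dyer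
conjecture*, arXiv:1407.1826v2 (2014) [BhargavaSkinnerZhang2014], §2.4 and Thms. 15–16 (root numbers in large families,
parity), §3 (the counting argument: proportions of the height family `E_{A,B} : y² = x³ + Ax + B`); the involution
`E_{A,B} ↦ E_{A,−B}` (quadratic twist by `−1` on coefficients) is from M. Bhargava, A. Shankar, *Ternary cubic forms having
bounded invariants …*, Ann. of Math. 181 (2015) [BhargavaShankarTernary2015], §4.1.

Reproduction (elementary, PROVED, Mathlib + the tree's height-family layer):
* `heightDensityGE_of_eventually_mul_card_le` — count ⇒ lower density (the converse direction of the tree's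
  `HeightDensityGE.eventually_mul_card_le`);
* `card_filter_sign_eq_one_eq` — **exactly half**: for ANY sign function `w : ℤ × ℤ → {±1}` that flips under `negB` on a
  `negB`-stable family `U`, as many members of `U` of height `< X` have `w = +1` as not (the tree's
  `card_filter_rootNumber_eq_one_eq` is the instance `w = rootNumber ∘ shortWeierstrass`); `half_sub_le_card_filter_parity` —
  with Dokchitser–Dokchitser parity on a good set `G`, at least `#U_X/2 − #(C ∖ G)_X` members of `U_X` have odd, and as many
  even, `p`-Selmer rank (the input of BSZ's linear programmes, `SelmerCounting`);
* `HeightDensityGE.mono`, `.of_le`, `.add_disjoint`, `heightDensityGE_of_cells` — lower height-densities are monotone and ADD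
  over pairwise disjoint cells (finite unions by induction).

Relation to the tree: this file IMPORTS and uses, rather than restates, `heightProportion_eq_card_div`, `negB`, `negB_negB`,
`negB_injective`, `isInHeightFamily_negB`, `naiveHeight_negB`, `negB_mem_heightFamilyBelow`, `card_filter_rootNumber_eq_one_eq`
(`BSDRankZeroDensity.lean`), `eventually_heightFamilyBelow_card_pos`, `HeightDensityGE.eventually_mul_card_le`
(`LeadingTermBSZAssemblyProofs.lean`), `heightProportion_or_of_disjoint` (`LeadingTermBSZNonsplitDensityProofs.lean`) and the
height family itself (`HeightFamily.lean`: `IsInHeightFamily`, `heightFamilyBelow`, `heightProportion`, `HeightDensityGE`).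
New relative to the tree: the sign-function generalisation, the parity count, and the union lemmas (the tree's BSZ assembly,
`LeadingTermBSZAssemblyProofs.lean`, is a ONE-cell argument).
Origin: `BSDPercentage/Bookkeeping.lean` (sha256 3f8682f0…, run of record 72) of the `pub-bsdpct` bundle's staged package
(BirchSwinnertonDyer / bsd-percentage), namespace-rewritten `BSDPercentage → Literature.NumberTheory.EllipticCurves.BhargavaSkinnerZhang2014`
(LEAN-IN-TREE rule, 2026-08-18) with the MODULE-MAP §2.1 dedup applied: the package's copies of lemmas ALREADY LANDED in
`Literature/NumberTheory/EllipticCurves/` (`heightProportion_eq_card_div`, `eventually_heightFamilyBelow_card_pos`,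
`HeightDensityGE.eventually_mul_card_le`, `negB` and its five lemmas, `heightProportion_or_of_disjoint`) are dropped and the tree's
are used; every other statement and proof is byte-identical (the packager's manifest lists the one adapted proof line and the
one rename).  "BSZ" / "paper" / `Statement.lean` / `Headline.lean` in the docstrings refer to the cited source and to that bundle.

What is NOT here: the cell theorems themselves (`CellBookkeeping`), the named hypothesis shapes and the multi-cell theorem of the
bundle (`Statement.lean` of the bundle, Summit-side pending a placement ruling), any density VALUE (the `Densities` files), any
statement about actual elliptic-curve invariants (the bookkeeping is over bare predicates / functions on `ℤ × ℤ`).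
-/

noncomputable section

open scoped Classical
open Filter Topology Finset

namespace Literature.NumberTheory.EllipticCurves.BhargavaSkinnerZhang2014

/-! ### Conversions between densities and counts

`heightProportion_eq_card_div`, `eventually_heightFamilyBelow_card_pos` and `HeightDensityGE.eventually_mul_card_le` are the
tree's (`BSDRankZeroDensity.lean`, `LeadingTermBSZAssemblyProofs.lean`); only the converse conversion is new here. -/

section Conversions

/-- Count ⇒ lower density: if for every `η > 0` eventually `(μ - η)·N(X) ≤ N_P(X)`, then
`HeightDensityGE P μ`. [folklore] -/
theorem heightDensityGE_of_eventually_mul_card_le {P : ℤ × ℤ → Prop} [DecidablePred P] {μ : ℝ}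
    (h : ∀ η : ℝ, 0 < η → ∀ᶠ X : ℕ in atTop,
      (μ - η) * (heightFamilyBelow X).card ≤ ((heightFamilyBelow X).filter P).card) :
    HeightDensityGE P μ := by
  intro ε hε
  filter_upwards [h ε hε, eventually_heightFamilyBelow_card_pos] with X hX hpos
  have hN : (0 : ℝ) < (heightFamilyBelow X).card := by exact_mod_cast hpos
  rw [heightProportion_eq_card_div, le_div_iff₀ hN]
  exact hX

end Conversions

/-! ### The involution `E_{A,B} ↦ E_{A,-B}` and the halving of a twist-stable family

`negB` and its lemmas (`negB_negB`, `negB_injective`, `isInHeightFamily_negB`, `naiveHeight_negB`, `negB_mem_heightFamilyBelow`) are the tree's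
(`BSDRankZeroDensity.lean`); `card_filter_sign_eq_one_eq` generalises the tree's `card_filter_rootNumber_eq_one_eq` to any
sign function. -/

section Involution

/-- **Exactly half.** If `U` is stable under `E ↦ E₋₁`, the "root number" `w` takes values in `{±1}` and
`w(E₋₁) = -w(E)` on `U`, then among the members of `U` of naive height `< X` as many have `w = +1` as
not (`negB` is a height-preserving bijection between the two sets).
[cite: BhargavaShankarTernary2015, §4.1; BhargavaSkinnerZhang2014, Thm 16 and §2.4] -/
theorem card_filter_sign_eq_one_eq (w : ℤ × ℤ → ℤ) (hw : ∀ AB, w AB = 1 ∨ w AB = -1)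
    (U : ℤ × ℤ → Prop) (hU : ∀ AB, U AB → U (negB AB))
    (hflip : ∀ AB, U AB → w (negB AB) = -w AB) (X : ℕ) :
    (((heightFamilyBelow X).filter U).filter (fun AB ↦ w AB = 1)).card =
      (((heightFamilyBelow X).filter U).filter (fun AB ↦ ¬ w AB = 1)).card := by
  refine Finset.card_bij (fun AB _ ↦ negB AB) (fun AB hAB ↦ ?_) (fun a₁ _ a₂ _ h ↦ negB_injective h)
    (fun AB' hAB' ↦ ⟨negB AB', ?_, negB_negB AB'⟩)
  · simp only [Finset.mem_filter] at hAB ⊢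
    refine ⟨⟨(negB_mem_heightFamilyBelow AB X).mpr hAB.1.1, hU AB hAB.1.2⟩, ?_⟩
    rw [hflip AB hAB.1.2, hAB.2]
    norm_num
  · simp only [Finset.mem_filter] at hAB' ⊢
    refine ⟨⟨(negB_mem_heightFamilyBelow AB' X).mpr hAB'.1.1, hU AB' hAB'.1.2⟩, ?_⟩
    rw [hflip AB' hAB'.1.2]
    rcases hw AB' with h | h
    · exact (hAB'.2 h).elim
    · rw [h]; norm_num

/-- From "exactly half" and parity to the input of the Selmer linear programmes: if on the good set `G`
the parity of the `p`-Selmer rank is that of the root number (Dokchitser–Dokchitser + `E(ℚ)[p] = 0`),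
then at least `#U_X/2 - #(C ∖ G)_X` members of `U_X` have odd, and at least as many have even, Selmer
rank (`U ⊆ C`). [cite: BhargavaSkinnerZhang2014, Thm 15 and §2.4] -/
theorem half_sub_le_card_filter_parity (w : ℤ × ℤ → ℤ) (hw : ∀ AB, w AB = 1 ∨ w AB = -1)
    (r : ℤ × ℤ → ℕ) (C U G : ℤ × ℤ → Prop) (hUC : ∀ AB, U AB → C AB)
    (hU : ∀ AB, U AB → U (negB AB)) (hflip : ∀ AB, U AB → w (negB AB) = -w AB)
    (hDD : ∀ AB, IsInHeightFamily AB → G AB → (Even (r AB) ↔ w AB = 1)) (X : ℕ) :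
    ((((heightFamilyBelow X).filter U).card : ℝ) / 2
        - ((heightFamilyBelow X).filter (fun AB ↦ C AB ∧ ¬ G AB)).card
        ≤ (((heightFamilyBelow X).filter U).filter (fun AB ↦ Odd (r AB))).card) ∧
    ((((heightFamilyBelow X).filter U).card : ℝ) / 2
        - ((heightFamilyBelow X).filter (fun AB ↦ C AB ∧ ¬ G AB)).card
        ≤ (((heightFamilyBelow X).filter U).filter (fun AB ↦ Even (r AB))).card) := by
  set UX := (heightFamilyBelow X).filter U with hUX
  set EX := (heightFamilyBelow X).filter (fun AB ↦ C AB ∧ ¬ G AB) with hEX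
  have hhalf := card_filter_sign_eq_one_eq w hw U hU hflip X
  rw [← hUX] at hhalf
  have hsplit := Finset.card_filter_add_card_filter_not (s := UX) (fun AB ↦ w AB = 1)
  have hsplitR : ((UX.filter fun AB ↦ w AB = 1).card : ℝ) + (UX.filter fun AB ↦ ¬ w AB = 1).card
      = UX.card := by exact_mod_cast hsplit
  have hhalfR : ((UX.filter fun AB ↦ w AB = 1).card : ℝ) = (UX.filter fun AB ↦ ¬ w AB = 1).card := by
    exact_mod_cast hhalf
  -- `{w ≠ 1} ⊆ {odd} ∪ E` and `{w = 1} ⊆ {even} ∪ E` inside `U_X`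
  have hmemUX : ∀ AB ∈ UX, IsInHeightFamily AB ∧ U AB := fun AB h ↦ by
    rw [hUX, Finset.mem_filter, mem_heightFamilyBelow_iff] at h
    exact ⟨h.1.1, h.2⟩
  have hodd : (UX.filter fun AB ↦ ¬ w AB = 1).card
      ≤ (UX.filter fun AB ↦ Odd (r AB)).card + EX.card := by
    calc (UX.filter fun AB ↦ ¬ w AB = 1).card
        ≤ ((UX.filter fun AB ↦ Odd (r AB)) ∪ EX).card := by
          refine Finset.card_le_card fun AB h ↦ ?_
          rw [Finset.mem_filter] at h
          rw [Finset.mem_union]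
          by_cases hG : G AB
          · left
            refine Finset.mem_filter.mpr ⟨h.1, ?_⟩
            have := hDD AB (hmemUX AB h.1).1 hG
            rcases Nat.even_or_odd (r AB) with he | ho
            · exact (h.2 (this.mp he)).elim
            · exact ho
          · right
            have hm : AB ∈ heightFamilyBelow X := (Finset.mem_filter.mp (hUX ▸ h.1)).1
            rw [hEX]
            exact Finset.mem_filter.mpr ⟨hm, hUC AB (hmemUX AB h.1).2, hG⟩
      _ ≤ _ := Finset.card_union_le _ _
  have heven : (UX.filter fun AB ↦ w AB = 1).card
      ≤ (UX.filter fun AB ↦ Even (r AB)).card + EX.card := by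
    calc (UX.filter fun AB ↦ w AB = 1).card
        ≤ ((UX.filter fun AB ↦ Even (r AB)) ∪ EX).card := by
          refine Finset.card_le_card fun AB h ↦ ?_
          rw [Finset.mem_filter] at h
          rw [Finset.mem_union]
          by_cases hG : G AB
          · left
            exact Finset.mem_filter.mpr ⟨h.1, (hDD AB (hmemUX AB h.1).1 hG).mpr h.2⟩
          · right
            have hm : AB ∈ heightFamilyBelow X := (Finset.mem_filter.mp (hUX ▸ h.1)).1
            rw [hEX]
            exact Finset.mem_filter.mpr ⟨hm, hUC AB (hmemUX AB h.1).2, hG⟩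
      _ ≤ _ := Finset.card_union_le _ _
  have hoddR : ((UX.filter fun AB ↦ ¬ w AB = 1).card : ℝ)
      ≤ (UX.filter fun AB ↦ Odd (r AB)).card + EX.card := by exact_mod_cast hodd
  have hevenR : ((UX.filter fun AB ↦ w AB = 1).card : ℝ)
      ≤ (UX.filter fun AB ↦ Even (r AB)).card + EX.card := by exact_mod_cast heven
  constructor <;> linarith

end Involution

/-! ### Union of pairwise disjoint cells -/

section Union

/-- Monotonicity of lower densities in the property. [folklore] -/
theorem HeightDensityGE.mono {P Q : ℤ × ℤ → Prop} (hPQ : ∀ AB, P AB → Q AB) {a : ℝ}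
    (h : HeightDensityGE P a) : HeightDensityGE Q a := by
  classical
  intro ε hε
  filter_upwards [h ε hε] with X hX
  refine le_trans hX ?_
  rw [heightProportion_eq_card_div P, heightProportion_eq_card_div Q]
  refine div_le_div_of_nonneg_right ?_ (Nat.cast_nonneg _)
  exact_mod_cast Finset.card_le_card fun AB h ↦ by
    rw [Finset.mem_filter] at h ⊢
    exact ⟨h.1, hPQ AB h.2⟩

/-- Monotonicity of lower densities in the constant. [folklore] -/
theorem HeightDensityGE.of_le {P : ℤ × ℤ → Prop} {a b : ℝ} (hab : a ≤ b) (h : HeightDensityGE P b) :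
    HeightDensityGE P a := fun ε hε ↦ (h ε hε).mono fun _ hX ↦ le_trans (by linarith) hX

/-- Lower densities add over two disjoint properties. [folklore] -/
theorem HeightDensityGE.add_disjoint {P Q : ℤ × ℤ → Prop} {a b : ℝ} (hP : HeightDensityGE P a)
    (hQ : HeightDensityGE Q b) (hPQ : ∀ AB, P AB → ¬ Q AB) :
    HeightDensityGE (fun AB ↦ P AB ∨ Q AB) (a + b) := by
  intro ε hε
  filter_upwards [hP (ε / 2) (by positivity), hQ (ε / 2) (by positivity)] with X hX1 hX2
  rw [heightProportion_or_of_disjoint (fun AB _ ↦ hPQ AB)]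
  linarith

/-- **Lower densities add over pairwise disjoint cells.** If the cells `C i` (`i ∈ s`) are pairwise
disjoint and at least a proportion `x i` of all curves lie in `C i` and satisfy `P`, then at least a
proportion `∑ x i` of all curves satisfy `P`. [folklore] -/
theorem heightDensityGE_of_cells {ι : Type*} (s : Finset ι) (P : ℤ × ℤ → Prop)
    (C : ι → ℤ × ℤ → Prop) (x : ι → ℝ)
    (hdisj : ∀ i ∈ s, ∀ j ∈ s, i ≠ j → ∀ AB, C i AB → ¬ C j AB)
    (h : ∀ i ∈ s, HeightDensityGE (fun AB ↦ P AB ∧ C i AB) (x i)) :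
    HeightDensityGE P (∑ i ∈ s, x i) := by
  classical
  -- the union over `s` of the `P ∧ C i`, by induction on `s`
  suffices H : HeightDensityGE (fun AB ↦ ∃ i ∈ s, P AB ∧ C i AB) (∑ i ∈ s, x i) from
    HeightDensityGE.mono (fun AB ⟨i, _, hP, _⟩ ↦ hP) H
  induction s using Finset.induction_on with
  | empty =>
    intro ε hε
    simp only [Finset.sum_empty]
    exact Eventually.of_forall fun X ↦ by linarith [heightProportion_nonneg (fun AB ↦ ∃ i ∈ (∅ : Finset ι), P AB ∧ C i AB) X]
  | @insert a s ha ih =>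
    rw [Finset.sum_insert ha]
    have h1 : HeightDensityGE (fun AB ↦ P AB ∧ C a AB) (x a) := h a (Finset.mem_insert_self a s)
    have h2 : HeightDensityGE (fun AB ↦ ∃ i ∈ s, P AB ∧ C i AB) (∑ i ∈ s, x i) :=
      ih (fun i hi j hj hij ↦ hdisj i (Finset.mem_insert_of_mem hi) j (Finset.mem_insert_of_mem hj) hij)
        (fun i hi ↦ h i (Finset.mem_insert_of_mem hi))
    have h12 := HeightDensityGE.add_disjoint h1 h2 (fun AB ⟨_, hCa⟩ ⟨i, hi, _, hCi⟩ ↦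
      hdisj a (Finset.mem_insert_self a s) i (Finset.mem_insert_of_mem hi)
        (fun h ↦ ha (h ▸ hi)) AB hCa hCi)
    refine HeightDensityGE.mono (fun AB h ↦ ?_) h12
    rcases h with ⟨hP, hC⟩ | ⟨i, hi, hP, hC⟩
    · exact ⟨a, Finset.mem_insert_self a s, hP, hC⟩
    · exact ⟨i, Finset.mem_insert_of_mem hi, hP, hC⟩

end Union

end Literature.NumberTheory.EllipticCurves.BhargavaSkinnerZhang2014
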